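import Literature.AlgebraicGeometry.Resolution.HironakaTauBaseChange
import Literature.AlgebraicGeometry.Resolution.HironakaDirectrixSpan
import Literature.AlgebraicGeometry.Resolution.HironakaDirectrix
import Literature.AlgebraicGeometry.Resolution.BlowupChartRsop
import Literature.AlgebraicGeometry.Resolution.BlowupDimension
import Literature.AlgebraicGeometry.Resolution.RegularLocalOrder
import Literature.AlgebraicGeometry.Resolution.PointBlowupOrder
import Literature.AlgebraicGeometry.Resolution.NearPointsRational
import HarnessLib

/-!
# The initial forms of the weak transform at the origin of a chart: `cl_μ(J′) ∋ F(Y′) + Y′_j H` and `τ(x′) ≥ τ(x)` (CoP1 (12))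

Topic: `Literature/AlgebraicGeometry/Resolution`. [CoP1] = Cossart–Piltant, J. Algebra 320 (2008),
proof of Lemma 4.3 (3), p. 8–9, for the blowing up of a closed point `x` of a regular threefold,
`r.s.p. (y_1, y_2, y_3)` chosen with `T_x = <Y_2, Y_3>` so that the near point `x′` is the origin
`(y_1′ = y_1, y_2′ = y_2/y_1, y_3′ = y_3/y_1)` of the chart `y_1 ≠ 0`:

> "If `x′` is near `x`, for any `f ∈ J_x` with `ord_x f = μ`, with `F := in_x f`, we have
> `F(Y_2′, Y_3′) ∈ cl_μ(J′) + (Y_1′)`. Therefore `T_{x′} + k(x′) Y_1′ = <Y_1′, Y_2′, Y_3′>`. (12)"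

PROVED here at ring level, for a regular local ring `R` of any embedding dimension `d`, a regular
system of parameters `c`, the chart `B_j` of the blowing up of `𝔪 = (c)`, a prime `𝔴` of `B_j`
over `𝔪` containing the chart generators `e_i = c_i/c_j` (`i ≠ j`) — the ORIGIN of the fibre
`ℙ^{d-1}` on the chart — and a localisation `L` of `B_j` at `𝔴`:

* `originFamily c j L = (…, e_i/1, …, c_j/1 (slot j), …)` is a regular system of parameters of the
  regular local ring `L` of embedding dimension `d` (`isRegularLocalRing_and_span_originFamily`;
  from `isRsopPart_chartFamily_reesChart` and `dim L ≤ dim R`, `BlowupDimension`);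
* `R → B_j/𝔴` is onto, `𝔴` is maximal and `k(R) → k(L)` is onto (`quotient_mk_comp_chartBase_
  surjective_origin`, `isMaximal_origin`, `residue_surjective_origin`);
* **(12)** `exists_add_X_mul_mem_initialForms_origin`: if `J′ ⊆ L` contains the weak transforms
  `F(e)/1` of the forms `F` of degree `μ ≥ 1` with `F(c) ∈ J` and `J′ ⊆ 𝔪_L^μ` (the origin is
  NEAR), then for every `G ∈ cl_μ(J)` not involving `Y_j` there is `H` with
  `θ_* G + Y_j H ∈ cl_μ(J′)` (`θ : k(R) → k(L)` the residue map; `cl_μ(J′)` w.r.t.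
  `originFamily`): write `F = F₀ + F₁`, `F₀` the part of a lift `F` of `G` avoiding `Y_j`,
  `F₁` with coefficients in `𝔪`; on the chart `F₁(e) ∈ 𝔪 B_j = c_j B_j`, so
  `F(e)/1 = F₀(c′) + c′_j b` in `L`; nearness and `F₀(c′) ∈ 𝔪_L^μ` give `c′_j b ∈ 𝔪_L^μ`, so
  `b ∈ 𝔪_L^{μ-1}` (order additivity, `RegularLocalOrder`) is a form `H₁(c′)` of degree `μ − 1`;
* **`τ(x′) ≥ τ(x)`** (`hironakaTauAt_le_hironakaTauAt_origin`): if ALL of `cl_μ(J)` avoids `Y_j`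
  (at a near origin with `τ(x) = d − 1` this is Hironaka's theorem, `PlaneNearForms` for
  `d = 3`), then `τ(cl_μ J) ≤ τ(cl_μ J′)`: killing `Y_j` maps `cl_μ(J′)` onto a set containing
  `θ_* cl_μ(J)` and does not increase `τ` (`HironakaTauBaseChange` for the residue isomorphism).

## Sources

* V. Cossart, O. Piltant, J. Algebra 320 (2008) 1051–1082, proof of Prop. 4.2 (b) and of
  Lemma 4.3 (3), (12), pp. 8–9. [CossartPiltant2008]
-/

noncomputable section

open IsLocalRing MvPolynomial

namespace Literature.AlgebraicGeometry.Resolution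

universe u

section Origin

variable {R : Type u} [CommRing R] {d : ℕ}
  (c : Fin d → R) (j : Fin d) (L : Type u) [CommRing L] [Algebra (chartRing c j) L]

/-- **The regular system of parameters of the local ring at the origin of the chart**:
`c′_j = c_j/1` (the exceptional divisor) and `c′_i = e_i/1 = (c_i/c_j)/1` for `i ≠ j`
([CoP1]: `(y_1′ = y_1, y_2′ = y_2/y_1, y_3′ = y_3/y_1)`). [cite: CossartPiltant2008, Lemma 4.3 (3)] -/
def originFamily : Fin d → L := fun i =>
  if i = j then (algebraMap (chartRing c j) L : chartRing c j →+* L) (chartBase c j (c j))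
  else (algebraMap (chartRing c j) L : chartRing c j →+* L) (chartGen c j i)

/-- `c′_j = c_j/1`. [folklore] -/
theorem originFamily_self :
    originFamily c j L j = (algebraMap (chartRing c j) L : chartRing c j →+* L) (chartBase c j (c j)) :=
  if_pos rfl

/-- `c′_i = e_i/1` for `i ≠ j`. [folklore] -/
theorem originFamily_of_ne {i : Fin d} (h : i ≠ j) :
    originFamily c j L i = (algebraMap (chartRing c j) L : chartRing c j →+* L) (chartGen c j i) :=
  if_neg h

variable {c j L}

/-- The range of `originFamily` is that of the `chartFamily` of `BlowupChartRsop` (all `e_i`,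
`i ≠ j`, enumerated by `finSuccAboveEquiv`). [folklore] -/
theorem range_chartFamily_eq_range_originFamily {n : ℕ} (c : Fin (n + 1) → R) (j : Fin (n + 1))
    (L : Type u) [CommRing L] [Algebra (chartRing c j) L] :
    Set.range (chartFamily c j (fun k : Fin 0 => Fin.elim0 k) L (chartBase c j) (chartGen c j)
      (fun k : Fin n => (finSuccAboveEquiv j) k)) = Set.range (originFamily c j L) := by
  ext z
  simp only [Set.mem_range, chartFamily]
  constructor
  · rintro ⟨i, rfl⟩
    refine Fin.cases ?_ (fun k => ?_) i
    · exact ⟨j, by rw [Fin.cons_zero, originFamily_self]⟩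
    · rw [Fin.cons_succ]
      obtain ⟨k', rfl⟩ : ∃ k' : Fin n, Fin.castAdd 0 k' = k := ⟨⟨k.1, k.2⟩, Fin.ext rfl⟩
      refine ⟨(finSuccAboveEquiv j k').1, ?_⟩
      rw [Fin.append_left, originFamily_of_ne c j L (finSuccAboveEquiv j k').2]
  · rintro ⟨i, rfl⟩
    by_cases h : i = j
    · subst h
      exact ⟨0, by rw [Fin.cons_zero, originFamily_self]⟩
    · obtain ⟨k, hk⟩ := (finSuccAboveEquiv j).surjective ⟨i, h⟩
      refine ⟨Fin.succ (Fin.castAdd 0 k), ?_⟩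
      rw [Fin.cons_succ, Fin.append_left, originFamily_of_ne c j L h, hk]

/-- **The local ring at the origin of the chart is regular of embedding dimension `d`, with
regular system of parameters `originFamily`.** [cite: CossartPiltant2008, Lemma 4.3 (3)] -/
theorem isRegularLocalRing_and_span_originFamily [IsRegularLocalRing R]
    (hd : (maximalIdeal R).spanFinrank = d)
    (c : Fin d → R) (hc : Ideal.span (Set.range c) = maximalIdeal R) (j : Fin d)
    (𝔴 : Ideal (chartRing c j)) [𝔴.IsPrime] (h𝔴 : 𝔴.comap (chartBase c j) = maximalIdeal R)
    (he : ∀ i, i ≠ j → chartGen c j i ∈ 𝔴)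
    (L : Type u) [CommRing L] [IsLocalRing L] [Algebra (chartRing c j) L]
    [IsLocalization.AtPrime L 𝔴] :
    IsRegularLocalRing L ∧ (maximalIdeal L).spanFinrank = d ∧
      Ideal.span (Set.range (originFamily c j L)) = maximalIdeal L := by
  classical
  obtain ⟨n, rfl⟩ : ∃ n, d = n + 1 := ⟨d - 1, by have := j.2; omega⟩
  -- the `chartFamily` `(c_j, e_i : i ≠ j)` is part of a regular system of parameters of `L`
  have hz : Ideal.span (Set.range (Fin.append c (fun k : Fin 0 => Fin.elim0 k))) = maximalIdeal R := by
    rw [← hc]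
    congr 1
    ext r
    constructor
    · rintro ⟨i, rfl⟩
      refine Fin.addCases (fun k => ⟨k, ?_⟩) (fun k => Fin.elim0 k) i
      rw [Fin.append_left]
    · rintro ⟨k, rfl⟩
      exact ⟨Fin.castAdd 0 k, by rw [Fin.append_left]⟩
  have hrsop := isRsopPart_chartFamily_reesChart c j (fun k : Fin 0 => Fin.elim0 k) hz
    (by rw [hd]) 𝔴 h𝔴 L (fun k : Fin n => (finSuccAboveEquiv j) k)
    (fun a b h => (finSuccAboveEquiv j).injective (Subtype.ext (congr_arg Subtype.val h)))
    (fun k => he _ (finSuccAboveEquiv j k).2)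
  haveI hLreg : IsRegularLocalRing L := hrsop.isRegularLocalRing
  obtain ⟨e, y, hdim, hy, hyz⟩ := hrsop.exists_rsop
  -- `dim L ≤ dim R = n + 1` forces `e = 0`
  haveI := isDomain_of_isRegularLocalRing R
  have hdimL : ringKrullDim L ≤ ringKrullDim R := ringKrullDim_localization_chartRing_le c j 𝔴 h𝔴 L
  have hR : ((maximalIdeal R).spanFinrank : WithBot ℕ∞) = ringKrullDim R :=
    IsRegularLocalRing.spanFinrank_maximalIdeal
  have hL : ((maximalIdeal L).spanFinrank : WithBot ℕ∞) = ringKrullDim L :=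
    IsRegularLocalRing.spanFinrank_maximalIdeal
  rw [← hR, ← hL, hd, hdim] at hdimL
  have he0 : e = 0 := by
    have : n + 0 + 1 + e ≤ n + 1 := by exact_mod_cast hdimL
    omega
  subst he0
  refine ⟨hLreg, by rw [hdim], ?_⟩
  -- `range y = range (chartFamily) = range (originFamily)`
  have hrange : Set.range y = Set.range (originFamily c j L) := by
    rw [← range_chartFamily_eq_range_originFamily]
    ext z
    constructor
    · rintro ⟨i, rfl⟩
      exact ⟨i, by rw [← hyz i]; rfl⟩
    · rintro ⟨i, rfl⟩
      exact ⟨Fin.castAdd 0 i, hyz i⟩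
  rw [← hrange, hy]

/-- Every element of `B_j` is congruent modulo `(e_i : i ≠ j)` to an element of `R`: for
`P ∈ R[T_i : i ≠ j]`, `P(e) ≡ φ(P(0))`. [folklore] -/
theorem eval₂Hom_sub_chartBase_constantCoeff_mem (c : Fin d → R) (j : Fin d)
    (P : MvPolynomial {i : Fin d // i ≠ j} R) :
    MvPolynomial.eval₂Hom (chartBase c j) (fun i : {i : Fin d // i ≠ j} => chartGen c j i.1) P -
        chartBase c j (MvPolynomial.constantCoeff P) ∈
      Ideal.span (Set.range fun i : {i : Fin d // i ≠ j} => chartGen c j i.1) := by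
  rw [← Ideal.Quotient.eq, ← RingHom.comp_apply, ← RingHom.comp_apply, ← RingHom.comp_apply]
  congr 1
  refine MvPolynomial.ringHom_ext (fun a => ?_) (fun i => ?_)
  · rw [RingHom.comp_apply, RingHom.comp_apply, RingHom.comp_apply, MvPolynomial.eval₂Hom_C,
      MvPolynomial.constantCoeff_C]
  · rw [RingHom.comp_apply, RingHom.comp_apply, RingHom.comp_apply, MvPolynomial.eval₂Hom_X',
      MvPolynomial.constantCoeff_X, map_zero, map_zero, Ideal.Quotient.eq_zero_iff_mem]
    exact Ideal.subset_span ⟨i, rfl⟩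

/-- **`R → B_j/𝔴` is onto at the origin** (`B_j` is generated by the `e_i` over `R`, and they lie
in `𝔴`). [cite: CossartPiltant2008, Lemma 4.3 (3)] -/
theorem quotient_mk_comp_chartBase_surjective_origin (c : Fin d → R) (j : Fin d)
    (𝔴 : Ideal (chartRing c j)) (he : ∀ i, i ≠ j → chartGen c j i ∈ 𝔴) :
    Function.Surjective ((Ideal.Quotient.mk 𝔴).comp (chartBase c j)) := by
  intro y
  obtain ⟨b, rfl⟩ := Ideal.Quotient.mk_surjective y
  obtain ⟨P, rfl⟩ := eval₂Hom_chartGen_surjective c j b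
  refine ⟨MvPolynomial.constantCoeff P, ?_⟩
  rw [RingHom.comp_apply, eq_comm, Ideal.Quotient.eq]
  have h := eval₂Hom_sub_chartBase_constantCoeff_mem c j P
  have hle : Ideal.span (Set.range fun i : {i : Fin d // i ≠ j} => chartGen c j i.1) ≤ 𝔴 :=
    Ideal.span_le.mpr (by rintro _ ⟨i, rfl⟩; exact he i.1 i.2)
  exact hle h

/-- Hence **the origin is a maximal ideal with residue field `R/𝔪`**. [cite: CossartPiltant2008, Lemma 4.3 (3)] -/
theorem isMaximal_origin [IsLocalRing R] (c : Fin d → R) (j : Fin d) (𝔴 : Ideal (chartRing c j))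
    [𝔴.IsPrime] (h𝔴 : 𝔴.comap (chartBase c j) = maximalIdeal R)
    (he : ∀ i, i ≠ j → chartGen c j i ∈ 𝔴) : 𝔴.IsMaximal := by
  have hsurj := quotient_mk_comp_chartBase_surjective_origin c j 𝔴 he
  obtain ⟨f, hf⟩ : ∃ f : R →+* chartRing c j ⧸ 𝔴, f = (Ideal.Quotient.mk 𝔴).comp (chartBase c j) :=
    ⟨_, rfl⟩
  rw [← hf] at hsurj
  haveI : Nontrivial (chartRing c j ⧸ 𝔴) :=
    Ideal.Quotient.nontrivial_iff.mpr (Ideal.IsPrime.ne_top ‹_›)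
  have hker : RingHom.ker f = maximalIdeal R := by
    ext r
    rw [RingHom.mem_ker, hf, RingHom.comp_apply, Ideal.Quotient.eq_zero_iff_mem, ← Ideal.mem_comap, h𝔴]
  have e : R ⧸ RingHom.ker f ≃+* chartRing c j ⧸ 𝔴 := RingHom.quotientKerEquivOfSurjective hsurj
  have hfield : IsField (chartRing c j ⧸ 𝔴) := by
    have h1 : IsField (R ⧸ RingHom.ker f) := by
      rw [hker]
      exact (Ideal.Quotient.maximal_ideal_iff_isField_quotient _).mp inferInstance
    exact MulEquiv.isField h1 e.symm.toMulEquiv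
  exact Ideal.Quotient.maximal_of_isField _ hfield

/-- The composite `R → B_j → L` is a local homomorphism. [folklore] -/
theorem isLocalHom_algebraMap_comp_chartBase [IsLocalRing R] (c : Fin d → R) (j : Fin d)
    (𝔴 : Ideal (chartRing c j)) [𝔴.IsPrime] (h𝔴 : 𝔴.comap (chartBase c j) = maximalIdeal R)
    (L : Type u) [CommRing L] [IsLocalRing L] [Algebra (chartRing c j) L]
    [IsLocalization.AtPrime L 𝔴] :
    IsLocalHom ((algebraMap (chartRing c j) L : chartRing c j →+* L).comp (chartBase c j)) := by
  refine ⟨fun r hr => ?_⟩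
  by_contra hnu
  have hrm : r ∈ maximalIdeal R := (IsLocalRing.mem_maximalIdeal r).mpr hnu
  rw [← h𝔴, Ideal.mem_comap] at hrm
  have : (algebraMap (chartRing c j) L : chartRing c j →+* L) (chartBase c j r) ∈ maximalIdeal L := by
    rw [← IsLocalization.AtPrime.map_eq_maximalIdeal 𝔴 L]
    exact Ideal.mem_map_of_mem _ hrm
  exact (IsLocalRing.mem_maximalIdeal _).mp this hr

/-- **`k(R) → k(L)` is onto at the origin** (a rational point). [cite: CossartPiltant2008, Lemma 4.3 (3)] -/
theorem residue_comp_surjective_origin [IsLocalRing R] (c : Fin d → R) (j : Fin d)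
    (𝔴 : Ideal (chartRing c j)) [𝔴.IsPrime] (h𝔴 : 𝔴.comap (chartBase c j) = maximalIdeal R)
    (he : ∀ i, i ≠ j → chartGen c j i ∈ 𝔴)
    (L : Type u) [CommRing L] [IsLocalRing L] [Algebra (chartRing c j) L]
    [IsLocalization.AtPrime L 𝔴] :
    Function.Surjective ((residue L).comp
      ((algebraMap (chartRing c j) L : chartRing c j →+* L).comp (chartBase c j))) := by
  haveI := isMaximal_origin c j 𝔴 h𝔴 he
  exact surjective_residue_comp_of_surjective_quotient_comp (S := L) (chartBase c j) 𝔴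
    (quotient_mk_comp_chartBase_surjective_origin c j 𝔴 he)

end Origin

/-! ## The part of a polynomial avoiding one variable -/

section AvoidVar

variable {A : Type*} [CommSemiring A] {σ : Type*} (j : σ)

/-- The part of `F` made of the monomials not involving `Y_j`. [folklore] -/
def avoidVar (F : MvPolynomial σ A) : MvPolynomial σ A :=
  ∑ m ∈ F.support.filter (fun m => m j = 0), monomial m (F.coeff m)

/-- Coefficients of `avoidVar`. [folklore] -/
theorem coeff_avoidVar [DecidableEq σ] (F : MvPolynomial σ A) (m : σ →₀ ℕ) :
    (avoidVar j F).coeff m = if m j = 0 then F.coeff m else 0 := by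
  classical
  rw [avoidVar, coeff_sum]
  simp only [coeff_monomial]
  rw [Finset.sum_ite_eq']
  simp only [Finset.mem_filter, MvPolynomial.mem_support_iff]
  by_cases h0 : m j = 0
  · rw [if_pos h0]
    by_cases hc : F.coeff m = 0
    · rw [hc]; split_ifs <;> rfl
    · rw [if_pos ⟨hc, h0⟩]
  · rw [if_neg h0, if_neg (fun h => h0 h.2)]

/-- `avoidVar` of a form is a form of the same degree. [folklore] -/
theorem isHomogeneous_avoidVar {F : MvPolynomial σ A} {n : ℕ} (hF : F.IsHomogeneous n) :
    (avoidVar j F).IsHomogeneous n := by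
  classical
  refine MvPolynomial.IsHomogeneous.sum _ _ _ fun m hm => ?_
  have hm' := (Finset.mem_filter.mp hm).1
  have hdeg : m.degree = n := by
    by_contra h
    exact (MvPolynomial.mem_support_iff.mp hm') (hF.coeff_eq_zero h)
  exact isHomogeneous_monomial _ hdeg

/-- The monomials of `avoidVar j F` do not involve `Y_j`. [folklore] -/
theorem apply_eq_zero_of_mem_support_avoidVar [DecidableEq σ] {F : MvPolynomial σ A} {m : σ →₀ ℕ}
    (hm : m ∈ (avoidVar j F).support) : m j = 0 := by
  by_contra h
  rw [MvPolynomial.mem_support_iff, coeff_avoidVar, if_neg h] at hm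
  exact hm rfl

/-- Evaluating a polynomial whose monomials avoid `Y_j` does not depend on the value at `j`.
[folklore] -/
theorem eval₂_eq_of_forall_apply_eq_zero {S : Type*} [CommSemiring S] (f : A →+* S) {g g' : σ → S}
    (h : ∀ i, i ≠ j → g i = g' i) {G : MvPolynomial σ A} (hG : ∀ m ∈ G.support, m j = 0) :
    MvPolynomial.eval₂ f g G = MvPolynomial.eval₂ f g' G := by
  classical
  conv_lhs => rw [G.as_sum, eval₂_sum]
  conv_rhs => rw [G.as_sum, eval₂_sum]
  refine Finset.sum_congr rfl fun m hm => ?_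
  rw [eval₂_monomial, eval₂_monomial]
  congr 1
  refine Finset.prod_congr rfl fun i hi => ?_
  have hij : i ≠ j := by
    rintro rfl
    exact (Finsupp.mem_support_iff.mp hi) (hG m hm)
  change g i ^ m i = g' i ^ m i
  rw [h i hij]

/-- **Killing `Y_j`** (`Y_j ↦ 0`, `Y_i ↦ Y_i`) fixes a polynomial not involving `Y_j`. [folklore] -/
theorem aeval_kill_eq_self_of_forall_apply_eq_zero [DecidableEq σ] {G : MvPolynomial σ A}
    (hG : ∀ m ∈ G.support, m j = 0) :
    MvPolynomial.aeval (fun i => if i = j then (0 : MvPolynomial σ A) else X i) G = G := by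
  have h := eval₂_eq_of_forall_apply_eq_zero j (MvPolynomial.C : A →+* MvPolynomial σ A)
    (g := fun i => if i = j then (0 : MvPolynomial σ A) else X i) (g' := X)
    (fun i hi => if_neg hi) hG
  rw [MvPolynomial.aeval_def, MvPolynomial.algebraMap_eq, h]
  exact MvPolynomial.eval₂_eta G

end AvoidVar

/-! ## (12): the initial forms of the weak transform at the origin -/

section Twelve

variable {R : Type u} [CommRing R] [IsRegularLocalRing R] {d : ℕ}

set_option maxHeartbeats 400000 in
/-- **[CoP1] (12): `F(Y′) ∈ cl_μ(J′) + (Y′_j)` at a near origin.** Let `c` be a regular system of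
parameters of `R`, `𝔴` the origin of the chart `B_j` of the blowing up of `𝔪 = (c)` (a prime over
`𝔪` containing the `e_i`, `i ≠ j`), `L` a localisation of `B_j` at `𝔴` with residue map
`θ : k(R) → k(L)`, `μ ≥ 1`, and `J′ ⊆ L` an ideal containing the weak transforms `F(e)/1` of the
forms `F` of degree `μ` with `F(c) ∈ J` and contained in `𝔪_L^μ` (the origin is near). Then for
every initial form `G ∈ cl_μ(J)` NOT INVOLVING `Y_j` there is a form `H` with
`θ_* G + Y_j · H ∈ cl_μ(J′)`, initial forms at `L` being taken w.r.t. `originFamily`.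
[cite: CossartPiltant2008, Lemma 4.3 (3), (12)] -/
theorem exists_add_X_mul_mem_initialForms_origin (hd : (maximalIdeal R).spanFinrank = d)
    (c : Fin d → R) (hc : Ideal.span (Set.range c) = maximalIdeal R) (j : Fin d)
    (𝔴 : Ideal (chartRing c j)) [𝔴.IsPrime] (h𝔴 : 𝔴.comap (chartBase c j) = maximalIdeal R)
    (he : ∀ i, i ≠ j → chartGen c j i ∈ 𝔴)
    (L : Type u) [CommRing L] [IsLocalRing L] [Algebra (chartRing c j) L]
    [IsLocalization.AtPrime L 𝔴]
    (θ : ResidueField R →+* ResidueField L)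
    (hθ : ∀ r, θ (residue R r) =
      residue L ((algebraMap (chartRing c j) L : chartRing c j →+* L) (chartBase c j r)))
    {J : Ideal R} {μ : ℕ} (hμ : 1 ≤ μ) {J' : Ideal L}
    (hJ' : ∀ F : MvPolynomial (Fin d) R, F.IsHomogeneous μ → MvPolynomial.eval c F ∈ J →
      (algebraMap (chartRing c j) L : chartRing c j →+* L)
        (MvPolynomial.eval₂Hom (chartBase c j) (fun i => chartGen c j i) F) ∈ J')
    (hnear : J' ≤ maximalIdeal L ^ μ)
    {G : MvPolynomial (Fin d) (ResidueField R)} (hG : G ∈ initialForms c J μ)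
    (hGj : ∀ m ∈ G.support, m j = 0) :
    ∃ H : MvPolynomial (Fin d) (ResidueField L),
      MvPolynomial.map θ G + X j * H ∈ initialForms (originFamily c j L) J' μ := by
  classical
  obtain ⟨hLreg, hdL, hspan⟩ := isRegularLocalRing_and_span_originFamily hd c hc j 𝔴 h𝔴 he L
  haveI := hLreg
  -- notation
  obtain ⟨φ, hφ⟩ : ∃ φ : R →+* chartRing c j, φ = chartBase c j := ⟨_, rfl⟩
  obtain ⟨α, hα⟩ : ∃ α : chartRing c j →+* L, α = (algebraMap (chartRing c j) L : chartRing c j →+* L) :=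
    ⟨_, rfl⟩
  obtain ⟨c', hc'⟩ : ∃ c' : Fin d → L, c' = originFamily c j L := ⟨_, rfl⟩
  rw [← hc'] at hspan
  have hc'j : c' j = α (φ (c j)) := by rw [hc', originFamily_self, hα, hφ]
  have hc'i : ∀ i, i ≠ j → c' i = α (chartGen c j i) := fun i hi => by
    rw [hc', originFamily_of_ne c j L hi, hα]
  -- a homogeneous lift `F` of `G`, split as `F₀ + F₁`
  obtain ⟨F, hF, hFJ, hFG⟩ := (mem_initialForms_iff c).mp hG
  obtain ⟨F₀, hF₀⟩ : ∃ F₀ : MvPolynomial (Fin d) R, F₀ = avoidVar j F := ⟨_, rfl⟩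
  have hF₀h : F₀.IsHomogeneous μ := hF₀ ▸ isHomogeneous_avoidVar j hF
  have hF₀j : ∀ m ∈ F₀.support, m j = 0 := fun m hm =>
    apply_eq_zero_of_mem_support_avoidVar j (hF₀ ▸ hm)
  have hF₀G : MvPolynomial.map (residue R) F₀ = G := by
    ext m
    rw [coeff_map, hF₀, coeff_avoidVar]
    by_cases h0 : m j = 0
    · rw [if_pos h0, ← coeff_map, hFG]
    · rw [if_neg h0, map_zero]
      symm
      by_contra hne
      exact h0 (hGj m (MvPolynomial.mem_support_iff.mpr hne))
  -- `F₁ = F - F₀` has coefficients in `𝔪`, so `F₁(e) ∈ 𝔪 B_j = (φ c_j)`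
  have hF₁coeff : ∀ m, (F - F₀).coeff m ∈ maximalIdeal R := by
    intro m
    rw [← IsLocalRing.residue_eq_zero_iff, coeff_sub, map_sub, ← coeff_map, ← coeff_map, hFG,
      hF₀G, sub_self]
  have hF₁mem : MvPolynomial.eval₂Hom φ (fun i => chartGen c j i) (F - F₀) ∈
      (maximalIdeal R).map φ := by
    have h1 : F - F₀ ∈ Ideal.map (MvPolynomial.C : R →+* MvPolynomial (Fin d) R) (maximalIdeal R) :=
      MvPolynomial.mem_map_C_iff.mpr hF₁coeff
    have h2 := Ideal.mem_map_of_mem (MvPolynomial.eval₂Hom φ (fun i => chartGen c j i)) h1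
    rwa [Ideal.map_map, MvPolynomial.eval₂Hom_comp_C] at h2
  have hmapφ : (maximalIdeal R).map φ = Ideal.span {φ (c j)} := by
    rw [← hc, hφ]
    exact Ideal.map_span_range_eq_span_singleton _ c j _
      (fun l => reesChartBase_apply_eq_mul_chartGen c j l)
  rw [hmapφ] at hF₁mem
  obtain ⟨b, hb⟩ := Ideal.mem_span_singleton'.mp hF₁mem
  -- in `L`: `F(e)/1 = F₀(c′) + c′_j · α b`
  have hevF₀ : α (MvPolynomial.eval₂Hom φ (fun i => chartGen c j i) F₀) =
      MvPolynomial.eval c' (MvPolynomial.map (α.comp φ) F₀) := by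
    rw [MvPolynomial.map_eval₂Hom, MvPolynomial.coe_eval₂Hom, MvPolynomial.eval_map]
    exact eval₂_eq_of_forall_apply_eq_zero j (α.comp φ) (fun i hi => (hc'i i hi).symm) hF₀j
  have hf' : α (MvPolynomial.eval₂Hom φ (fun i => chartGen c j i) F) ∈ J' := by
    rw [hα, hφ]; exact hJ' F hF hFJ
  have hdecomp : α (MvPolynomial.eval₂Hom φ (fun i => chartGen c j i) F) =
      MvPolynomial.eval c' (MvPolynomial.map (α.comp φ) F₀) + c' j * α b := by
    have hFF : F = F₀ + (F - F₀) := by ring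
    conv_lhs => rw [hFF, map_add, map_add, ← hb, map_mul, hevF₀, ← hc'j]
    ring
  have hF₀c' : MvPolynomial.eval c' (MvPolynomial.map (α.comp φ) F₀) ∈ maximalIdeal L ^ μ := by
    rw [← hspan]
    exact (Ideal.mem_span_pow_iff_exists_isHomogeneous c' _).mpr ⟨_, hF₀h.map _, rfl⟩
  have hcb : c' j * α b ∈ maximalIdeal L ^ μ := by
    have h1 := hnear hf'
    rw [hdecomp] at h1
    exact (Ideal.add_mem_iff_right _ hF₀c').mp h1
  -- order additivity: `α b ∈ 𝔪_L^{μ-1}`, a form `H₁(c′)` of degree `μ - 1`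
  have hc'rsop : IsRsopPart (c' ∘ id) := isRsopPart_comp_of_rsop hdL c' hspan id Function.injective_id
  have hc'j2 : c' j ∉ maximalIdeal L ^ 2 := hc'rsop.not_mem_sq j
  have hbmem : α b ∈ maximalIdeal L ^ (μ - 1) := by
    rcases Nat.lt_or_ge μ 2 with hμ1 | hμ2
    · rw [show μ - 1 = 0 by omega, pow_zero, Ideal.one_eq_top]; trivial
    · by_contra hb'
      have h2 : α b ∉ maximalIdeal L ^ (μ - 2 + 1) := by rwa [show μ - 2 + 1 = μ - 1 by omega]
      have h3 := mul_not_mem_pow_of_not_mem_pow (p := 1) hc'j2 h2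
      rw [show 1 + (μ - 2) + 1 = μ by omega] at h3
      exact h3 hcb
  obtain ⟨H₁, hH₁h, hH₁⟩ := exists_isHomogeneous_of_mem_span_pow c' (μ - 1)
    (by rw [hspan]; exact hbmem)
  -- the form `G′ = (α ∘ φ)_* F₀ + Y_j H₁` has `G′(c′) = F(e)/1 ∈ J′`
  have hXH : (X j * H₁ : MvPolynomial (Fin d) L).IsHomogeneous μ := by
    have := (isHomogeneous_X L j).mul hH₁h
    rwa [show 1 + (μ - 1) = μ by omega] at this
  have hG'h : (MvPolynomial.map (α.comp φ) F₀ + X j * H₁).IsHomogeneous μ := (hF₀h.map _).add hXH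
  have hG'J : MvPolynomial.eval c' (MvPolynomial.map (α.comp φ) F₀ + X j * H₁) ∈ J' := by
    rw [map_add, map_mul, MvPolynomial.eval_X, hH₁, ← hdecomp]
    exact hf'
  have hmem : MvPolynomial.map (residue L) (MvPolynomial.map (α.comp φ) F₀ + X j * H₁) ∈
      initialForms c' J' μ :=
    (mem_initialForms_iff c').mpr ⟨_, hG'h, hG'J, rfl⟩
  -- and reduces to `θ_* G + Y_j H̄₁`
  have hcompθ : (residue L).comp (α.comp φ) = θ.comp (residue R) := by
    ext r
    rw [RingHom.comp_apply, RingHom.comp_apply, RingHom.comp_apply, hθ, hα, hφ]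
  refine ⟨MvPolynomial.map (residue L) H₁, ?_⟩
  rw [hc']  at hmem
  rw [map_add, map_mul, MvPolynomial.map_X, MvPolynomial.map_map, hcompθ, ← MvPolynomial.map_map,
    hF₀G] at hmem
  exact hmem

/-! ## `τ(x′) ≥ τ(x)` at a near origin -/

variable {k : Type*} [Field k]

/-- **Killing `Y_j` on linear forms**: `ℓ ↦ ℓ − ℓ(e_j) Y_j^∨`. [folklore] -/
def killDual (j : Fin d) : Module.Dual k (Fin d → k) →ₗ[k] Module.Dual k (Fin d → k) where
  toFun ℓ := ℓ - ℓ (Pi.single j 1) • (LinearMap.proj j : Module.Dual k (Fin d → k))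
  map_add' ℓ ℓ' := by rw [LinearMap.add_apply, add_smul]; abel
  map_smul' a ℓ := by rw [RingHom.id_apply, LinearMap.smul_apply, smul_eq_mul, smul_sub, mul_smul]

/-- Values of `killDual` on the standard basis. [folklore] -/
theorem killDual_single (j : Fin d) (ℓ : Module.Dual k (Fin d → k)) (i : Fin d) :
    killDual j ℓ (Pi.single i 1) = if i = j then 0 else ℓ (Pi.single i 1) := by
  simp only [killDual, LinearMap.coe_mk, AddHom.coe_mk, LinearMap.sub_apply, LinearMap.smul_apply,
    LinearMap.coe_proj, Function.eval, Pi.single_apply, smul_eq_mul]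
  by_cases h : i = j
  · subst h; rw [if_pos rfl, if_pos rfl, mul_one, sub_self]
  · rw [if_neg h, if_neg (Ne.symm h), mul_zero, sub_zero]

/-- Killing `Y_j` maps linear forms to linear forms: `Φ(Σ a_i Y_i) = Σ_{i ≠ j} a_i Y_i`. [folklore] -/
theorem aeval_kill_linearFormPoly (j : Fin d) (ℓ : Module.Dual k (Fin d → k)) :
    MvPolynomial.aeval (fun i => if i = j then (0 : MvPolynomial (Fin d) k) else X i)
        (linearFormPoly k ℓ) = linearFormPoly k (killDual j ℓ) := by
  rw [linearFormPoly, linearFormPoly, map_sum]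
  refine Finset.sum_congr rfl fun i _ => ?_
  rw [map_mul, MvPolynomial.algHom_C, MvPolynomial.algebraMap_eq, MvPolynomial.aeval_X,
    killDual_single]
  by_cases h : i = j
  · rw [if_pos h, if_pos h, mul_zero, map_zero, zero_mul]
  · rw [if_neg h, if_neg h]

/-- **Images of `k[T]` under an algebra endomorphism acting linearly on linear forms**: if
`Ψ(linearFormPoly ℓ) = linearFormPoly (g ℓ)` for a linear `g`, then `Ψ(k[T]) ⊆ k[g(T)]`.
[folklore] -/
theorem apply_mem_linearFormsSubalgebra_map
    (Ψ : MvPolynomial (Fin d) k →ₐ[k] MvPolynomial (Fin d) k)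
    (g : Module.Dual k (Fin d → k) →ₗ[k] Module.Dual k (Fin d → k))
    (hΨ : ∀ ℓ, Ψ (linearFormPoly k ℓ) = linearFormPoly k (g ℓ))
    (T : Submodule k (Module.Dual k (Fin d → k))) {F : MvPolynomial (Fin d) k}
    (hF : F ∈ linearFormsSubalgebra k T) : Ψ F ∈ linearFormsSubalgebra k (T.map g) := by
  unfold linearFormsSubalgebra at hF ⊢
  induction hF using Algebra.adjoin_induction with
  | mem G hG =>
    obtain ⟨ℓ, hℓ, rfl⟩ := hG
    rw [hΨ]
    exact Algebra.subset_adjoin ⟨g ℓ, Submodule.mem_map_of_mem hℓ, rfl⟩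
  | algebraMap a => rw [AlgHom.commutes]; exact Subalgebra.algebraMap_mem _ _
  | add G H _ _ ihG ihH => rw [map_add]; exact Subalgebra.add_mem _ ihG ihH
  | mul G H _ _ ihG ihH => rw [map_mul]; exact Subalgebra.mul_mem _ ihG ihH

set_option maxHeartbeats 400000 in
/-- **[CoP1] (b) at a near origin: `τ(x′) ≥ τ(x)`** — "`T_{x′} + k(x′) Y_1′ = <Y_1′, Y_2′, Y_3′>`
(12)". In the situation of `exists_add_X_mul_mem_initialForms_origin`, if NO initial form of `J`
involves `Y_j` (at a near origin with `τ(x) = d − 1` this is Hironaka's Theorem 2, proved in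
`PlaneNearForms` for `d = 3`), then `τ(cl_μ J) ≤ τ(cl_μ J′)`: killing `Y_j` maps `cl_μ(J′)` onto a
set containing `θ_* cl_μ(J)` and does not increase `τ`, and `θ : k(R) ≅ k(L)`.
[cite: CossartPiltant2008, proof of Prop. 4.2 (b) and Lemma 4.3 (3), (12)] -/
theorem hironakaTauAt_le_hironakaTauAt_origin (hd : (maximalIdeal R).spanFinrank = d)
    (c : Fin d → R) (hc : Ideal.span (Set.range c) = maximalIdeal R) (j : Fin d)
    (𝔴 : Ideal (chartRing c j)) [𝔴.IsPrime] (h𝔴 : 𝔴.comap (chartBase c j) = maximalIdeal R)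
    (he : ∀ i, i ≠ j → chartGen c j i ∈ 𝔴)
    (L : Type u) [CommRing L] [IsLocalRing L] [Algebra (chartRing c j) L]
    [IsLocalization.AtPrime L 𝔴]
    (θ : ResidueField R →+* ResidueField L)
    (hθ : ∀ r, θ (residue R r) =
      residue L ((algebraMap (chartRing c j) L : chartRing c j →+* L) (chartBase c j r)))
    {J : Ideal R} {μ : ℕ} (hμ : 1 ≤ μ) {J' : Ideal L}
    (hJ' : ∀ F : MvPolynomial (Fin d) R, F.IsHomogeneous μ → MvPolynomial.eval c F ∈ J →
      (algebraMap (chartRing c j) L : chartRing c j →+* L)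
        (MvPolynomial.eval₂Hom (chartBase c j) (fun i => chartGen c j i) F) ∈ J')
    (hnear : J' ≤ maximalIdeal L ^ μ)
    (hall : ∀ G ∈ initialForms c J μ, ∀ m ∈ G.support, m j = 0) :
    hironakaTauAt c J μ ≤ hironakaTauAt (originFamily c j L) J' μ := by
  classical
  -- `θ` is an isomorphism
  have hcompθ : (residue L).comp ((algebraMap (chartRing c j) L : chartRing c j →+* L).comp
      (chartBase c j)) = θ.comp (residue R) := by
    ext r
    rw [RingHom.comp_apply, RingHom.comp_apply, RingHom.comp_apply, hθ]
  have hθsurj : Function.Surjective θ := by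
    have h := residue_comp_surjective_origin c j 𝔴 h𝔴 he L
    rw [hcompθ, RingHom.coe_comp] at h
    exact Function.Surjective.of_comp h
  have hθbij : Function.Bijective θ := ⟨θ.injective, hθsurj⟩
  have hcoe : ((RingEquiv.ofBijective θ hθbij : ResidueField R ≃+* ResidueField L) :
      ResidueField R →+* ResidueField L) = θ := RingHom.ext fun x => rfl
  have hτeq : hironakaTau (ResidueField L) (MvPolynomial.map θ ''
      (initialForms c J μ : Set (MvPolynomial (Fin d) (ResidueField R)))) = hironakaTauAt c J μ := by
    rw [← hcoe]
    exact hironakaTau_image_map_eq (RingEquiv.ofBijective θ hθbij) _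
  -- `cl_μ(J′) ⊆ k[T′]` with `dim T′ = τ(x′)`
  obtain ⟨T', hS'T', hT'⟩ := exists_subset_linearFormsSubalgebra_finrank_eq (ResidueField L)
    (initialForms (originFamily c j L) J' μ : Set (MvPolynomial (Fin d) (ResidueField L)))
  -- killing `Y_j`: `θ_* cl_μ(J) ⊆ k[killDual(T′)]`
  have hsub : MvPolynomial.map θ '' (initialForms c J μ : Set (MvPolynomial (Fin d) (ResidueField R))) ⊆
      linearFormsSubalgebra (ResidueField L) (T'.map (killDual j)) := by
    rintro _ ⟨G, hG, rfl⟩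
    obtain ⟨H, hH⟩ := exists_add_X_mul_mem_initialForms_origin hd c hc j 𝔴 h𝔴 he L θ hθ hμ hJ'
      hnear hG (hall G hG)
    have hkill : MvPolynomial.aeval (fun i => if i = j then (0 : MvPolynomial (Fin d) (ResidueField L))
        else X i) (MvPolynomial.map θ G + X j * H) = MvPolynomial.map θ G := by
      rw [map_add, map_mul, MvPolynomial.aeval_X, if_pos rfl, zero_mul, add_zero]
      refine aeval_kill_eq_self_of_forall_apply_eq_zero j fun m hm => hall G hG m ?_
      exact MvPolynomial.support_map_subset _ _ hm
    rw [← hkill]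
    exact apply_mem_linearFormsSubalgebra_map _ (killDual j) (aeval_kill_linearFormPoly j) T'
      (hS'T' hH)
  calc hironakaTauAt c J μ
      = hironakaTau (ResidueField L) (MvPolynomial.map θ ''
          (initialForms c J μ : Set (MvPolynomial (Fin d) (ResidueField R)))) := hτeq.symm
    _ ≤ Module.finrank (ResidueField L) (T'.map (killDual j)) :=
        hironakaTau_le_finrank_of_subset _ hsub
    _ ≤ Module.finrank (ResidueField L) T' := Submodule.finrank_map_le _ _
    _ = hironakaTauAt (originFamily c j L) J' μ := hT'

end Twelve

end Literature.AlgebraicGeometry.Resolution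

end
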